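/-
Copyright (c) 2026 the pub-hodgecm-mathlib formalisation cell (harness21).  Prover seat hodgecm-mathlib-LH4-p01 (g10), carve (c6) «R IS GLUED» of SIG-F3-5 v1 6925585c
(F3-5 pen LH7-p04 (g11→g12) ∕ LH10-p01 (g10); road M6 → F3 «TOT-Λ by over-orders», route (B), LEAD F0P3a-plan T14-66; dealer LH4-plan), 2026-09-03.  FILE 1 of 2.
-/
import Literature.NumberTheory.Automorphic.GluedOverOrderLevelLaw   -- ★ F3-3 FILE 1 (LH4-p01 (g9) p852989): `char_and_valuation_eq_of_odd_level ∕ _even_level`, `valuation_map_eq_of_mem_span_of_not_mem`, `mem_span_uniformizer_pow_of_valuation_eq`, `valuation_coe_eq_one_of_isUnit`; brings ★ (L2′) `mem_range_eval₂_iff_eisenstein`, `lam_sq_eq_eisenstein`, ★ (L1′) `coord_mul_eisenstein`, ★ [T2-c] `coord_unique`, ★ O1 `IsUniformizingElement`, `span_singleton_eq_span_uniformizer_pow_of_valuation_eq`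
import HarnessLib

/-!
# The order of an Eisenstein pair is glued: `𝒪_E[(u, λ)] = G(N, n, c)`, and the level law `n = min(2·ord c, 2N+1)` (FILE 1 of 2; FILE 2 = `GluedOverOrderOfUnitaryPair`)
# (Neukirch I §12; Serre, Corps locaux I §6; Rogawski 1990 §4.9)

Topic `NumberTheory/Automorphic`; namespace `Literature.NumberTheory.Automorphic`.  THEOREMS ONLY (no definition, no instance, no notation, no named fact, no `sorry`).
Cell `pub/hodgecm-mathlib` (D-0151), crux H413 = `stmt-HodgeConjecture-24833`; road M6 → F3 «TOT-Λ by over-orders» (route (B)); this file is carve **(c6) «R IS GLUED»** of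
SIG-F3-5 v1 (S2): the level data of the type-(2) order `R := 𝒪[τB]` — the CONVERSE of ★ (UG) `exists_unitary_generator_glued` (which shows that every good glued over-order at a
monogenic level HAS a deep unitary generator).  CURRENCY = ★ F3-3 ∕ ★ (L3′) ∕ ★ F3-1a: `𝒪 = 𝒪[E]` (`ValuativeRel E`), the abstract Eisenstein quadratic ring
`O₁ = j𝒪 ⊕ j𝒪·θ`, the monogenic order `R = 𝒪[x]`, `x = (u, λ)`, `λ = j p + j q θ`, realised as the range of `f ↦ f(x)` on `𝒪[X]`, and ★ F3-1a's glued literal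
`G(N, n, c) = {(y, j b₀ + j c₀ Π_N) | y ≡ b₀ + c₀ c (mod ϖ^n)}`, `Π_N = j(ϖ^N)·θ`, spelled out at each use.
HONEST LABEL: HC_CM is proved only modulo the 7 printed citations (2 remaining named inputs: hLiu418 = stmt-HodgeConjecture-24832, h413 = stmt-HodgeConjecture-24833) until rung 0
closes; commutative algebra, count-neutral (pays no organ, opens no road; zero label movement until F5 ★ + desk rider).

THE MATHEMATICS.  §1: write `q = ε ϖ^N` (`ε` a unit) and put `c := ε⁻¹(u − p)`.  By the three-term normal form (★ (L2′)) every element of `R` is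
`Σ cᵢ (u, λ)^i = (c₀′ + c₁′u + c₂′u², j(c₀′ + c₁′p + c₂′(tp − D)) + j((c₁′ + c₂′t) ε)·Π_N)`, whose first coordinate is `≡ b₀ + c₀ c` modulo the EXACT-LEVEL element
`χ(u) = u² − tu + D ∈ ϖ^n 𝒪^×`; conversely the congruence is solved for `c₂′` by dividing by `χ(u)`.  Hence `R = G(N, n, c)` — for ANY commutative `O₁` and any `t, D` with
`λ² − tλ + D = 0` (no multiplication table needed).  §2 (LEVEL LAW): reading `λ²` on coordinates gives `t = 2p + aq`, `D = p² + apq − q²k`, so `χ(u) = ε²·f_N(c)` with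
`f_N(x) = x² − ϖ^N a x − ϖ^{2N} k`, and ★ FILE 1's exact-valuation law yields `n = 2N+1` if `c ∈ (ϖ^{N+1})`, `n = 2M` if `c ∈ (ϖ^M) ∖ (ϖ^{M+1})`, `M ≤ N` (`M = 0`, i.e. `n = 0`,
is the product order `𝒪 × O_N`; a DEEP pair `u ≡ p ≡ 1` has `M ≥ 1`; the `b ≥ 1` reading of an exact level under a DVR instance is ★ (ii) `level_of_valuation_char_eq`
(LH10-p01 p853024) — here no DVR instance is assumed and the `n = 0` row is kept, since ★ (W1)'s `hT` ranges over all `(n′, N′)`).  FILE 2 (`GluedOverOrderOfUnitaryPair`): for a UNITARY pair the character is hermitian and has a `σO`-fixed representative `ιO y` at the same monogenic level.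
No `2`-adic token (`t = 2p + aq` is the trace identity, any
characteristic), no `d`, no parity binder (T14-66 KILL clause honoured).
[cite: Neukirch1999, Ch. I §12] [cite: SerreLocalFields1979, Ch. I §6 Prop. 17–18] [cite: Rogawski1990, §4.9 Lemma 4.9.3 p. 56, Prop. 4.9.1 (b) p. 55]

* §1 `exists_isUnit_mul_uniformizer_pow_eq`, **`exists_coe_range_eval₂_eq_glued`** (R is glued).
* §2 `trace_norm_eq_of_coord` (`t = 2p + aq`, `D = p² + apq − q²k`), `eq_of_valuation_pow_eq`, **`level_of_eisenstein_pair`** (the level law), `level_of_eisenstein_pair_of_deep`.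

## References
* [Neukirch1999] J. Neukirch, *Algebraic Number Theory*, Grundlehren 322 (1999): Ch. I §12 (orders, conductors; orders in products as fibre products).
* [SerreLocalFields1979] J.-P. Serre, *Local Fields*, GTM 67 (1979): Ch. I §6 Prop. 17–18 (Eisenstein equations, uniformiser bookkeeping).
* [Rogawski1990] J. D. Rogawski, *Automorphic Representations of Unitary Groups in Three Variables*, Ann. of Math. Stud. 123 (1990): §4.9 Lemma 4.9.3 p. 56, Prop. 4.9.1 (b) p. 55
  (the type-(2) orders `𝒪[γ]` and their invariants `(N, n)`).
-/

set_option autoImplicit false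

noncomputable section

open scoped ValuativeRel
open Polynomial ValuativeRel

namespace Literature.NumberTheory.Automorphic

variable {E : Type*} [Field E] [ValuativeRel E] {O₁ : Type*} [CommRing O₁] (j : 𝒪[E] →+* O₁) (θ : O₁)

/-! ## §1 `R = 𝒪[(u, λ)]` is the glued order `G(N, n, c)` -/

/-- An element of exact valuation `v(ϖ)^N` is `ε·ϖ^N` with `ε` a unit. [cite: SerreLocalFields1979, Ch. I §6] -/
theorem exists_isUnit_mul_uniformizer_pow_eq {ϖ : E} (hϖ : IsUniformizingElement ϖ) {q : 𝒪[E]} {N : ℕ}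
    (hN : valuation E (q : E) = valuation E ϖ ^ N) :
    ∃ ε : 𝒪[E], IsUnit ε ∧ q = ε * (⟨ϖ, hϖ.mem⟩ : 𝒪[E]) ^ N := by
  obtain ⟨r, hr⟩ := Ideal.mem_span_singleton'.1 (mem_span_uniformizer_pow_of_valuation_eq hϖ hN)
  refine ⟨r, ?_, hr.symm⟩
  have hv0 : valuation E ϖ ≠ 0 := (Valuation.ne_zero_iff _).2 hϖ.ne_zero
  have hpow : valuation E ϖ ^ N ≠ 0 := pow_ne_zero _ hv0
  have hvr : valuation E (r : E) * valuation E ϖ ^ N = 1 * valuation E ϖ ^ N := by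
    have h := congrArg (fun x : 𝒪[E] => valuation E (x : E)) hr
    simp only [Subring.coe_mul, SubmonoidClass.coe_pow, map_mul, map_pow] at h
    rw [h, hN, one_mul]
  exact (Valuation.integer.integers (valuation E)).isUnit_iff_valuation_eq_one.2 (mul_right_cancel₀ hpow hvr)

/-- **(c6-A) THE ORDER OF AN EISENSTEIN PAIR IS GLUED.**  For `x = (u, λ)`, `λ = j p + j q θ` with `λ² − tλ + D = 0`, `v(q) = v(ϖ)^N` and `v(u² − tu + D) = v(ϖ)^n`, there is
`c ∈ 𝒪` with `q·c = ϖ^N·(u − p)` (i.e. `c = ε⁻¹(u − p)`, `q = εϖ^N`) such that `𝒪[x] = G(N, n, c)` as sets (★ F3-1a's glued literal, token for token).  Valid for ANY commutative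
`O₁` and any `j, θ, t, D` (three-term normal form ★ (L2′) and division by the exact-level element `χ(u) = u² − tu + D`).
[cite: Neukirch1999, Ch. I §12] [cite: Rogawski1990, §4.9 Lemma 4.9.3 p. 56] -/
theorem exists_coe_range_eval₂_eq_glued {ϖ : E} (hϖ : IsUniformizingElement ϖ) {u p q t D : 𝒪[E]}
    (hlam2 : (j p + j q * θ) ^ 2 - j t * (j p + j q * θ) + j D = 0) {N n : ℕ}
    (hN : valuation E (q : E) = valuation E ϖ ^ N) (hn : valuation E ((u * u - t * u + D : 𝒪[E]) : E) = valuation E ϖ ^ n) :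
    ∃ c : 𝒪[E], q * c = (⟨ϖ, hϖ.mem⟩ : 𝒪[E]) ^ N * (u - p) ∧
      ((Polynomial.eval₂RingHom (RingHom.prod (RingHom.id 𝒪[E]) j) ((u, j p + j q * θ) : 𝒪[E] × O₁)).range : Set (𝒪[E] × O₁)) =
        {z : 𝒪[E] × O₁ | ∃ b₀ c₀ : 𝒪[E], z.2 = j b₀ + j c₀ * (j ((⟨ϖ, hϖ.mem⟩ : 𝒪[E]) ^ N) * θ) ∧
          z.1 - (b₀ + c₀ * c) ∈ Ideal.span {(⟨ϖ, hϖ.mem⟩ : 𝒪[E]) ^ n}} := by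
  set π : 𝒪[E] := ⟨ϖ, hϖ.mem⟩ with hπdef
  set L : O₁ := j p + j q * θ with hL
  set I : Ideal 𝒪[E] := Ideal.span ({π ^ n} : Set 𝒪[E]) with hI
  obtain ⟨ε, hεu, hq⟩ := exists_isUnit_mul_uniformizer_pow_eq hϖ hN
  obtain ⟨εU, rfl⟩ := hεu
  set c : 𝒪[E] := ↑εU⁻¹ * (u - p) with hc
  have hεinv : (εU : 𝒪[E]) * ↑εU⁻¹ = 1 := Units.mul_inv _
  have hεc : (εU : 𝒪[E]) * c = u - p := by rw [hc, ← mul_assoc, hεinv, one_mul]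
  have hδ : u - p - (εU : 𝒪[E]) * c = 0 := by rw [hεc, sub_self]
  have hχI : u * u - t * u + D ∈ I := mem_span_uniformizer_pow_of_valuation_eq hϖ hn
  have hsq : L ^ 2 = j (t * p - D) + j (t * q) * θ := lam_sq_eq_eisenstein j θ hL hlam2
  refine ⟨c, by rw [hq, mul_right_comm, hεc, mul_comm], ?_⟩
  ext z
  rw [SetLike.mem_coe, mem_range_eval₂_iff_eisenstein j u hlam2 z]
  constructor
  · -- `⊆`: `z = Σ (cᵢ, j cᵢ) x^i`
    rintro ⟨cv, rfl⟩
    refine ⟨cv 0 + cv 1 * p + cv 2 * (t * p - D), (cv 1 + cv 2 * t) * (εU : 𝒪[E]), ?_, ?_⟩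
    · simp only [Prod.snd_add, Prod.snd_mul, Prod.pow_snd, hsq]
      rw [hL, hq]
      simp only [map_add, map_mul, map_sub, map_pow]
      ring
    · simp only [Prod.fst_add, Prod.fst_mul, Prod.pow_fst]
      have key : cv 0 + cv 1 * u + cv 2 * u ^ 2 - (cv 0 + cv 1 * p + cv 2 * (t * p - D) + (cv 1 + cv 2 * t) * (εU : 𝒪[E]) * c) =
          cv 1 * (u - p - (εU : 𝒪[E]) * c) + cv 2 * ((u * u - t * u + D) + t * (u - p - (εU : 𝒪[E]) * c)) := by ring
      rw [key, hδ, mul_zero, zero_add, mul_zero, add_zero]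
      exact Ideal.mul_mem_left _ _ hχI
  · -- `⊇`: solve for `c₂` by dividing by the exact-level element `χ(u)`
    rintro ⟨b₀, c₀, hz2, hz1⟩
    obtain ⟨r, hr⟩ := Ideal.mem_span_singleton'.1 hz1
    have hrhs : r * π ^ n ∈ Ideal.span ({u * u - t * u + D} : Set 𝒪[E]) := by
      rw [span_singleton_eq_span_uniformizer_pow_of_valuation_eq hϖ hn]
      exact Ideal.mul_mem_left _ _ (Ideal.mem_span_singleton_self _)
    obtain ⟨c₂, hc₂⟩ := Ideal.mem_span_singleton'.1 hrhs
    set c₁ : 𝒪[E] := c₀ * ↑εU⁻¹ - c₂ * t with hc₁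
    set cc : 𝒪[E] := b₀ - c₁ * p - c₂ * (t * p - D) with hcc
    refine ⟨![cc, c₁, c₂], Prod.ext ?_ ?_⟩
    · -- first coordinate: `cc + c₁u + c₂u² = b₀ + c₀c + rϖ^n = z.1`
      simp only [Prod.fst_add, Prod.fst_mul, Prod.pow_fst, Matrix.cons_val_zero, Matrix.cons_val_one, Matrix.cons_val_two,
        Matrix.head_cons, Matrix.tail_cons]
      have hz1' : z.1 = b₀ + c₀ * c + r * π ^ n := by linear_combination (-1 : 𝒪[E]) * hr
      rw [hz1', hcc, hc₁, hc]
      linear_combination (-1 : 𝒪[E]) * hc₂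
    · -- second coordinate: `j cc + j c₁ λ + j c₂ λ² = j b₀ + j c₀ Π_N`
      simp only [Prod.snd_add, Prod.snd_mul, Prod.pow_snd, Matrix.cons_val_zero, Matrix.cons_val_one, Matrix.cons_val_two,
        Matrix.head_cons, Matrix.tail_cons, hsq]
      rw [hz2, hcc, hc₁, hL, hq]
      simp only [map_mul, map_sub, map_pow]
      have hj : j (εU : 𝒪[E]) * j (↑εU⁻¹ : 𝒪[E]) = 1 := by rw [← map_mul, hεinv, map_one]
      linear_combination (-(j c₀ * j π ^ N * θ)) * hj

/-! ## §2 The level law `n = min(2·ord c, 2N + 1)` -/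

/-- **TRACE AND NORM ON COORDINATES**: if `λ = j p + j q θ` satisfies `λ² − tλ + D = 0` in `O₁ = j𝒪 ⊕ j𝒪θ`, `θ² = j a θ + j k`, and `q ≠ 0`, then `t = 2p + aq` and
`D = p² + apq − q²k` (compare the `(1, θ)`-coordinates of `λ²`; `𝒪` is a domain).  Characteristic-free. [cite: SerreLocalFields1979, Ch. I §6 Prop. 18] -/
theorem trace_norm_eq_of_coord {a k : 𝒪[E]} (hθ : θ ^ 2 = j a * θ + j k)
    (hcoord : ∀ z : O₁, ∃! bc : 𝒪[E] × 𝒪[E], z = j bc.1 + j bc.2 * θ) {p q t D : 𝒪[E]} (hq0 : q ≠ 0)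
    (hlam2 : (j p + j q * θ) ^ 2 - j t * (j p + j q * θ) + j D = 0) :
    t = 2 * p + a * q ∧ D = p * p + a * p * q - q * q * k := by
  have hsq : (j p + j q * θ) ^ 2 = j (t * p - D) + j (t * q) * θ := lam_sq_eq_eisenstein j θ rfl hlam2
  have hsq' : (j p + j q * θ) ^ 2 = j (p * p + q * q * k) + j (p * q + q * p + q * q * a) * θ := by
    rw [sq, coord_mul_eisenstein j θ hθ]
  obtain ⟨h1, h2⟩ := coord_unique j θ hcoord (hsq.symm.trans hsq')
  have ht : t = 2 * p + a * q := by
    have : t * q = (2 * p + a * q) * q := by rw [h2]; ring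
    exact mul_right_cancel₀ hq0 this
  exact ⟨ht, by linear_combination (-1 : 𝒪[E]) * h1 + p * ht⟩

/-- Powers of `v(ϖ)` are injective in the exponent (`0 < v(ϖ) < 1`). [cite: SerreLocalFields1979, Ch. I §6] -/
theorem eq_of_valuation_pow_eq {ϖ : E} (hϖ : IsUniformizingElement ϖ) {m n : ℕ}
    (h : valuation E ϖ ^ m = valuation E ϖ ^ n) : m = n := by
  have hv0 : valuation E ϖ ≠ 0 := (Valuation.ne_zero_iff _).2 hϖ.ne_zero
  have hv1 : valuation E ϖ < 1 := hϖ.valuation_lt_one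
  rcases Nat.lt_trichotomy m n with hlt | heq | hgt
  · exact absurd h (pow_lt_pow_right_of_lt_one₀ (zero_lt_iff.2 hv0) hv1 hlt).ne'
  · exact heq
  · exact absurd h (pow_lt_pow_right_of_lt_one₀ (zero_lt_iff.2 hv0) hv1 hgt).ne

/-- **(c6-B) THE LEVEL LAW.**  In the Eisenstein frame (`θ² = j a θ + j k`, `a ∈ 𝔪`, `k` a uniformiser class, unique coordinates), for `λ = j p + j q θ` with `λ² − tλ + D = 0`,
`v(q) = v(ϖ)^N`, `v(u² − tu + D) = v(ϖ)^n` and `q·c = ϖ^N·(u − p)`: EITHER `n = 2N+1` and `c ∈ (ϖ^{N+1})` (ODD level), OR `n = 2M` with `M ≤ N` and `c ∈ (ϖ^M) ∖ (ϖ^{M+1})`,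
`v(c) = v(ϖ)^M` (EVEN level) — i.e. `n = min(2·ord c, 2N+1)`; `M = 0` (`c` a unit, `n = 0`) is the product order `𝒪 × O_N`.  Proof: `χ(u) = ε²·f_N(c)`,
`f_N(x) = x² − ϖ^N a x − ϖ^{2N} k`, and ★ FILE 1's exact-valuation law (no DVR instance, `n = 0` included; cf. ★ (ii) `level_of_valuation_char_eq`, the `b ≥ 1` reading of an
exact level). [cite: Neukirch1999, Ch. I §12] [cite: SerreLocalFields1979, Ch. I §6 Prop. 17–18] [cite: Rogawski1990, §4.9 Lemma 4.9.3 p. 56] -/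
theorem level_of_eisenstein_pair {a k : 𝒪[E]} (hθ : θ ^ 2 = j a * θ + j k) (ha : a ∈ IsLocalRing.maximalIdeal 𝒪[E])
    {ϖ : E} (hϖ : IsUniformizingElement ϖ) (hk₁ : valuation E (k : E) = valuation E ϖ)
    (hcoord : ∀ z : O₁, ∃! bc : 𝒪[E] × 𝒪[E], z = j bc.1 + j bc.2 * θ) {u p q t D c : 𝒪[E]}
    (hlam2 : (j p + j q * θ) ^ 2 - j t * (j p + j q * θ) + j D = 0) {N n : ℕ}
    (hqc : q * c = (⟨ϖ, hϖ.mem⟩ : 𝒪[E]) ^ N * (u - p))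
    (hN : valuation E (q : E) = valuation E ϖ ^ N) (hn : valuation E ((u * u - t * u + D : 𝒪[E]) : E) = valuation E ϖ ^ n) :
    (n = 2 * N + 1 ∧ c ∈ Ideal.span {(⟨ϖ, hϖ.mem⟩ : 𝒪[E]) ^ (N + 1)}) ∨
      ∃ M : ℕ, M ≤ N ∧ n = 2 * M ∧ valuation E (c : E) = valuation E ϖ ^ M ∧
        c ∈ Ideal.span {(⟨ϖ, hϖ.mem⟩ : 𝒪[E]) ^ M} ∧ c ∉ Ideal.span {(⟨ϖ, hϖ.mem⟩ : 𝒪[E]) ^ (M + 1)} := by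
  classical
  set π : 𝒪[E] := ⟨ϖ, hϖ.mem⟩ with hπdef
  have hπ0 : π ≠ 0 := hϖ.coe_ne_zero
  have hv1 : valuation E ϖ < 1 := hϖ.valuation_lt_one
  have hk : k ∈ IsLocalRing.maximalIdeal 𝒪[E] := by
    refine (IsLocalRing.mem_maximalIdeal _).2 fun hku => ?_
    have h1 := valuation_coe_eq_one_of_isUnit hku
    rw [hk₁] at h1
    exact hv1.ne h1
  -- 1. `q = ε ϖ^N`, `ε c = u − p`
  obtain ⟨ε, hεu, hq⟩ := exists_isUnit_mul_uniformizer_pow_eq hϖ hN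
  have hεc : ε * c = u - p := by
    have : π ^ N * (ε * c) = π ^ N * (u - p) := by rw [← hqc, hq]; ring
    exact mul_left_cancel₀ (pow_ne_zero _ hπ0) this
  have hq0 : q ≠ 0 := by rw [hq]; exact mul_ne_zero hεu.ne_zero (pow_ne_zero _ hπ0)
  -- 2. trace and norm, and `χ(u) = ε²·f_N(c)`
  obtain ⟨ht, hD⟩ := trace_norm_eq_of_coord j θ hθ hcoord hq0 hlam2
  have hfac : u * u - t * u + D = ε * ε * (c * c - π ^ N * a * c - π ^ (2 * N) * k) := by
    rw [ht, hD]
    linear_combination (-(u - p + ε * c) + a * (ε * π ^ N)) * hεc + (-(a * (u - p)) - k * (q + ε * π ^ N)) * hq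
  have hvε : valuation E (ε : E) = 1 := valuation_coe_eq_one_of_isUnit hεu
  have hfv : valuation E ((c * c - π ^ N * a * c - π ^ (2 * N) * k : 𝒪[E]) : E) = valuation E ϖ ^ n := by
    have h := hn
    rw [hfac, Subring.coe_mul, Subring.coe_mul, map_mul, map_mul, hvε, one_mul, one_mul] at h
    exact h
  -- 3. case split on `c ∈ (ϖ^{N+1})`
  by_cases hc : c ∈ Ideal.span ({π ^ (N + 1)} : Set 𝒪[E])
  · left
    obtain ⟨-, hval⟩ := char_and_valuation_eq_of_odd_level hϖ ha hk₁ hc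
    have h := hval c (by rw [sub_self]; exact Ideal.zero_mem _)
    exact ⟨eq_of_valuation_pow_eq hϖ (hfv.symm.trans h), hc⟩
  · right
    set M : ℕ := Nat.findGreatest (fun m => c ∈ Ideal.span ({π ^ m} : Set 𝒪[E])) N with hM
    have hMN : M ≤ N := Nat.findGreatest_le N
    have hP0 : c ∈ Ideal.span ({π ^ 0} : Set 𝒪[E]) := by
      rw [pow_zero, Ideal.span_singleton_one]; exact Submodule.mem_top
    have hcM : c ∈ Ideal.span ({π ^ M} : Set 𝒪[E]) :=
      Nat.findGreatest_spec (P := fun m => c ∈ Ideal.span ({π ^ m} : Set 𝒪[E])) (Nat.zero_le N) hP0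
    have hcM1 : c ∉ Ideal.span ({π ^ (M + 1)} : Set 𝒪[E]) := by
      intro h
      by_cases hlt : M + 1 ≤ N
      · exact Nat.findGreatest_is_greatest (Nat.lt_succ_self M) hlt h
      · have hMeq : M = N := by omega
        rw [hMeq] at h
        exact hc h
    refine ⟨M, hMN, ?_, ?_, hcM, hcM1⟩
    · rcases Nat.eq_zero_or_pos M with hM0 | hMpos
      · -- `c` is a unit: `f_N(c)` is a unit, `n = 0`
        rw [hM0] at hcM1
        have hcu : IsUnit c := by
          by_contra hnu
          refine hcM1 ?_
          rw [zero_add, pow_one, ← hϖ.span_eq]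
          exact (IsLocalRing.mem_maximalIdeal _).2 hnu
        have hm : π ^ N * a * c + π ^ (2 * N) * k ∈ IsLocalRing.maximalIdeal 𝒪[E] :=
          Ideal.add_mem _ (Ideal.mul_mem_right _ _ (Ideal.mul_mem_left _ _ ha)) (Ideal.mul_mem_left _ _ hk)
        have hfu : IsUnit (c * c - π ^ N * a * c - π ^ (2 * N) * k) := by
          by_contra hnu
          have hmem : c * c - π ^ N * a * c - π ^ (2 * N) * k ∈ IsLocalRing.maximalIdeal 𝒪[E] := (IsLocalRing.mem_maximalIdeal _).2 hnu
          have hcc : c * c ∈ IsLocalRing.maximalIdeal 𝒪[E] := by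
            have : c * c = (c * c - π ^ N * a * c - π ^ (2 * N) * k) + (π ^ N * a * c + π ^ (2 * N) * k) := by ring
            rw [this]; exact Ideal.add_mem _ hmem hm
          rcases (IsLocalRing.maximalIdeal.isMaximal 𝒪[E]).isPrime.mem_or_mem hcc with h | h <;>
            exact ((IsLocalRing.mem_maximalIdeal _).1 h) hcu
        have h1 := valuation_coe_eq_one_of_isUnit hfu
        rw [hfv, ← pow_zero (valuation E ϖ)] at h1
        rw [hM0, mul_zero]
        exact eq_of_valuation_pow_eq hϖ h1
      · have hcv : valuation E (c : E) = valuation E ϖ ^ M :=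
          valuation_map_eq_of_mem_span_of_not_mem (RingHom.id 𝒪[E]) hϖ hϖ rfl hcM hcM1
        obtain ⟨-, hval⟩ := char_and_valuation_eq_of_even_level hϖ ha hk hMpos hMN hcv
        have h := hval c (by rw [sub_self]; exact Ideal.zero_mem _)
        exact eq_of_valuation_pow_eq hϖ (hfv.symm.trans h)
    · rcases Nat.eq_zero_or_pos M with hM0 | hMpos
      · rw [hM0] at hcM1
        have hcu : IsUnit c := by
          by_contra hnu
          refine hcM1 ?_
          rw [zero_add, pow_one, ← hϖ.span_eq]
          exact (IsLocalRing.mem_maximalIdeal _).2 hnu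
        rw [hM0, pow_zero]
        exact valuation_coe_eq_one_of_isUnit hcu
      · exact valuation_map_eq_of_mem_span_of_not_mem (RingHom.id 𝒪[E]) hϖ hϖ rfl hcM hcM1

/-- **THE LEVEL LAW FOR A DEEP PAIR** (`u ≡ 1`, `p ≡ 1 (mod 𝔪)`): as `level_of_eisenstein_pair`, with `1 ≤ M` in the even branch (`c = ε⁻¹(u − p) ∈ 𝔪`).
[cite: Neukirch1999, Ch. I §12] [cite: Rogawski1990, §4.9 Lemma 4.9.3 p. 56] -/
theorem level_of_eisenstein_pair_of_deep {a k : 𝒪[E]} (hθ : θ ^ 2 = j a * θ + j k) (ha : a ∈ IsLocalRing.maximalIdeal 𝒪[E])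
    {ϖ : E} (hϖ : IsUniformizingElement ϖ) (hk₁ : valuation E (k : E) = valuation E ϖ)
    (hcoord : ∀ z : O₁, ∃! bc : 𝒪[E] × 𝒪[E], z = j bc.1 + j bc.2 * θ) {u p q t D c : 𝒪[E]}
    (hlam2 : (j p + j q * θ) ^ 2 - j t * (j p + j q * θ) + j D = 0)
    (hu1 : u - 1 ∈ IsLocalRing.maximalIdeal 𝒪[E]) (hp1 : p - 1 ∈ IsLocalRing.maximalIdeal 𝒪[E]) {N n : ℕ}
    (hqc : q * c = (⟨ϖ, hϖ.mem⟩ : 𝒪[E]) ^ N * (u - p))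
    (hN : valuation E (q : E) = valuation E ϖ ^ N) (hn : valuation E ((u * u - t * u + D : 𝒪[E]) : E) = valuation E ϖ ^ n) :
    (n = 2 * N + 1 ∧ c ∈ Ideal.span {(⟨ϖ, hϖ.mem⟩ : 𝒪[E]) ^ (N + 1)}) ∨
      ∃ M : ℕ, 1 ≤ M ∧ M ≤ N ∧ n = 2 * M ∧ valuation E (c : E) = valuation E ϖ ^ M ∧
        c ∈ Ideal.span {(⟨ϖ, hϖ.mem⟩ : 𝒪[E]) ^ M} ∧ c ∉ Ideal.span {(⟨ϖ, hϖ.mem⟩ : 𝒪[E]) ^ (M + 1)} := by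
  set π : 𝒪[E] := ⟨ϖ, hϖ.mem⟩ with hπdef
  have hπ0 : π ≠ 0 := hϖ.coe_ne_zero
  rcases level_of_eisenstein_pair j θ hθ ha hϖ hk₁ hcoord hlam2 hqc hN hn with hodd | ⟨M, hMN, hnM, hcv, hcM, hcM1⟩
  · exact Or.inl hodd
  · refine Or.inr ⟨M, ?_, hMN, hnM, hcv, hcM, hcM1⟩
    -- `c ∈ 𝔪 = (ϖ)`, so `M ≠ 0`
    obtain ⟨ε, hεu, hq⟩ := exists_isUnit_mul_uniformizer_pow_eq hϖ hN
    have hεc : ε * c = u - p := by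
      have : π ^ N * (ε * c) = π ^ N * (u - p) := by rw [← hqc, hq]; ring
      exact mul_left_cancel₀ (pow_ne_zero _ hπ0) this
    have hcm : c ∈ IsLocalRing.maximalIdeal 𝒪[E] := by
      have hεcm : ε * c ∈ IsLocalRing.maximalIdeal 𝒪[E] := by
        rw [hεc, show u - p = (u - 1) - (p - 1) by ring]
        exact Ideal.sub_mem _ hu1 hp1
      rcases (IsLocalRing.maximalIdeal.isMaximal 𝒪[E]).isPrime.mem_or_mem hεcm with h | h
      · exact absurd hεu ((IsLocalRing.mem_maximalIdeal _).1 h)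
      · exact h
    by_contra hM0
    have hM0' : M = 0 := by omega
    rw [hM0', zero_add, pow_one, ← hϖ.span_eq] at hcM1
    exact hcM1 hcm

end Literature.NumberTheory.Automorphic

end
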